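import Summits.Ventures.Crystal3D.Theorems.StickyWulffConstantCoaxialWallLawPayerAssembly
import Summits.Ventures.Crystal3D.Theorems.StickyWulffConstantTextureLiminfTexShadowSampleDeficitUpperUnif
import HarnessLib

/-!
# The payer assembly (deficit form) with ONE ABSOLUTE constant — row cone of the With-currency restatement

HONEST FRAMING. Venture `Summits/Ventures/Crystal3D` (cell `crystal3d-full`), helper `--supports` the crux
`CoaxialWallLaw` (stmt-Ventures-19481, `route-Ventures-StickyWulffConstant`, REGISTERED line `WallLedgerF`).
RUNG CREDIT ONLY — pure bookkeeping; F-C1 not moved; nothing about the crux is claimed.  cf-p1 DECISION (lxvii)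
(2026-08-29T00:13:52Z), restatement programme in the explicit-constant currency of `…CoaxialWallLawLedgerWithDefs`
(`TwoSlabLedgerWith C R₀ q`), ROW CONE (owner 19481-p1): under lane F's chain of record
(`coaxialWallLaw_of_onSiteFlatA_v2A_nineHalves ← …TwoRowsCertifiedA ← …ReachCoreOfRowsA ← …PayerTransPlaneRowA /
…PayerTwinTwoPlateRowA`) the ONLY pair-dependent constant is the `C` of `twoSlab_cross_le_of_deficit A₁ t₁ A₂ t₂ R₀`
(`…PayerAssembly`: `affineSampleDeficit_upper` twice).  This file is that lemma VERBATIM with the UNIFORM sample bound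
`affineSampleDeficit_upper_unif` (wulff-p2, `…TexShadowSampleDeficitUpperUnif`):

* **`twoSlab_cross_le_of_deficit_unif`** : `∃ K ≥ 0` ABSOLUTE such that for EVERY pair of grains and every `R₀ ≥ 10`, in
  every clamped cell a weighted payer bound `c·π·ρ² − C₀(1+h)ρ ≤ Σ_{z ∈ X, −R₀−2 ≤ z₂ ≤ h+R₀+2} (12 − deg z)` gives
  `cross(P₁, X∖P₁) + cross(P₂, Y) ≤ D(Y) + (φ₁ + φ₂ − c/2)·π·ρ² + (K(1 + R₀) + C₀/2)(1 + h)ρ`.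

WHAT THIS IS NOT: not the stub; no counting is done here; F-C1 not moved.
-/

noncomputable section

namespace Summit.Ventures.Crystal3D.Theorems

open Summit.Ventures.Crystal3D Finset
open Literature.MathematicalPhysics.StatisticalMechanics (fccStacking barlowStacking contactDeficiency)
open scoped InnerProductSpace

open scoped Classical in
/-- **The payer assembly, deficit form, with ONE ABSOLUTE constant** («each end consumes its own missing contact»):
there is `K ≥ 0` such that for every pair of moved fcc grains, every `R₀ ≥ 10` and every clamped cell, a weighted payer
bound `c·π·ρ² − C₀·(1+h)·ρ ≤ Σ_{z ∈ X, −R₀−2 ≤ z₂ ≤ h+R₀+2} (12 − deg z)` gives the stub-shaped inequality at charge `c/2`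
with constant `K·(1 + R₀) + C₀/2`.  The proof of `twoSlab_cross_le_of_deficit` verbatim with
`affineSampleDeficit_upper_unif`. -/
theorem twoSlab_cross_le_of_deficit_unif : ∃ K : ℝ, 0 ≤ K ∧
    ∀ (A₁ : EuclideanSpace ℝ (Fin 3) ≃ₗᵢ[ℝ] EuclideanSpace ℝ (Fin 3)) (t₁ : EuclideanSpace ℝ (Fin 3))
      (A₂ : EuclideanSpace ℝ (Fin 3) ≃ₗᵢ[ℝ] EuclideanSpace ℝ (Fin 3)) (t₂ : EuclideanSpace ℝ (Fin 3))
      (R₀ : ℝ), 10 ≤ R₀ →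
    ∀ h : ℝ, 0 ≤ h → ∀ ρ : ℝ, R₀ ≤ ρ →
      ∀ X P₁ P₂ : Finset (EuclideanSpace ℝ (Fin 3)),
      (∀ p ∈ X, ∀ q ∈ X, p ≠ q → 1 ≤ dist p q) → P₁ ⊆ X → P₂ ⊆ X \ P₁ →
      (∀ p ∈ X, -(2 * R₀) ≤ p 2 ∧ p 2 ≤ h + 2 * R₀ ∧ p 0 ^ 2 + p 1 ^ 2 ≤ ρ ^ 2) →
      (∀ p, p ∈ P₁ ↔ (p ∈ (fun q => A₁ q + t₁) '' fccStacking 1 (Real.sqrt (2 / 3)) ∧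
        -(2 * R₀) ≤ p 2 ∧ p 2 ≤ -R₀ ∧ p 0 ^ 2 + p 1 ^ 2 ≤ ρ ^ 2)) →
      (∀ p, p ∈ P₂ ↔ (p ∈ (fun q => A₂ q + t₂) '' fccStacking 1 (Real.sqrt (2 / 3)) ∧
        h + R₀ ≤ p 2 ∧ p 2 ≤ h + 2 * R₀ ∧ p 0 ^ 2 + p 1 ^ 2 ≤ ρ ^ 2)) →
      ∀ c C₀ : ℝ, 0 ≤ C₀ →
      c * Real.pi * ρ ^ 2 - C₀ * (1 + h) * ρ ≤
        ∑ z ∈ X.filter (fun z => -R₀ - 2 ≤ z 2 ∧ z 2 ≤ h + R₀ + 2),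
          ((12 : ℝ) - ((X.filter fun q => dist z q = 1).card : ℝ)) →
      ((((P₁ ×ˢ (X \ P₁)).filter fun pq => dist pq.1 pq.2 = 1).card : ℕ) : ℝ) +
        ((((P₂ ×ˢ ((X \ P₁) \ P₂)).filter fun pq => dist pq.1 pq.2 = 1).card : ℕ) : ℝ) ≤
        contactDeficiency ((X \ P₁) \ P₂) +
          (Real.sqrt 2 / 4 * ∑ᶠ w ∈ {w ∈ fccStacking 1 (Real.sqrt (2 / 3)) | ‖w‖ = 1},
              |⟪w, A₁.symm (EuclideanSpace.single (2 : Fin 3) (1 : ℝ))⟫_ℝ| +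
            Real.sqrt 2 / 4 * ∑ᶠ w ∈ {w ∈ fccStacking 1 (Real.sqrt (2 / 3)) | ‖w‖ = 1},
              |⟪w, A₂.symm (EuclideanSpace.single (2 : Fin 3) (1 : ℝ))⟫_ℝ| - c / 2) * Real.pi * ρ ^ 2 +
          (K * (1 + R₀) + C₀ / 2) * (1 + h) * ρ := by
  set e₃ : EuclideanSpace ℝ (Fin 3) := EuclideanSpace.single (2 : Fin 3) (1 : ℝ) with he₃
  obtain ⟨Cu, hCu⟩ := affineSampleDeficit_upper_unif
  refine ⟨2 * |Cu| + 120 * Real.sqrt 2 * Real.pi + 11520, by positivity, ?_⟩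
  intro A₁ t₁ A₂ t₂ R₀ hR₀ h hh ρ hρ X P₁ P₂ hX hP₁X hP₂X₁ hcyl hP₁ hP₂ c C₀ hC₀ hpay
  set φ₁ : ℝ := Real.sqrt 2 / 4 * ∑ᶠ w ∈ {w ∈ fccStacking 1 (Real.sqrt (2 / 3)) | ‖w‖ = 1},
      |⟪w, A₁.symm e₃⟫_ℝ| with hφ₁
  set φ₂ : ℝ := Real.sqrt 2 / 4 * ∑ᶠ w ∈ {w ∈ fccStacking 1 (Real.sqrt (2 / 3)) | ‖w‖ = 1},
      |⟪w, A₂.symm e₃⟫_ℝ| with hφ₂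
  have hP₂X : P₂ ⊆ X := hP₂X₁.trans sdiff_subset
  have hρ0 : (0 : ℝ) ≤ ρ := by linarith
  have hR1 : (1 : ℝ) ≤ R₀ := by linarith
  -- (1) the two slab samples from above, UNIFORM constant `Cu (1 + R₀)`
  have hD₁ := hCu A₁ t₁ R₀ hR1 (-(2 * R₀)) (-R₀) (by ring) ρ hρ P₁ hP₁
  have hD₂ := hCu A₂ t₂ R₀ hR1 (h + R₀) (h + 2 * R₀) (by ring) ρ hρ P₂ hP₂
  -- (2) the deficit ledger, credited set = the interior window
  have hled := interior_ledger_ge_faces_add_deficit A₁ t₁ A₂ t₂ X P₁ P₂ R₀ h ρ hR₀ hh hρ hX hcyl hP₁X hP₂X hP₁ hP₂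
    (fun y => -R₀ - 2 ≤ y 2 ∧ y 2 ≤ h + R₀ + 2)
    (fun y _ hy _ => ⟨by linarith [hy.1], by linarith [hy.2]⟩)
  beta_reduce at hled
  have hf₁ : Real.sqrt 2 / 4 * ∑ w ∈ fccSlots, |⟪A₁ w, e₃⟫_ℝ| = φ₁ := by
    rw [hφ₁, finsum_unit_fcc_symm_eq_sum_slots]
  have hf₂ : Real.sqrt 2 / 4 * ∑ w ∈ fccSlots, |⟪A₂ w, e₃⟫_ℝ| = φ₂ := by
    rw [hφ₂, finsum_unit_fcc_symm_eq_sum_slots]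
  rw [hf₁, hf₂, ← two_mul_contactDeficiency_eq_sum X] at hled
  -- (3) the two splits of the skeleton
  have hs₁ := contactDeficiency_sdiff_split hP₁X
  have hs₂ := contactDeficiency_sdiff_split hP₂X₁
  -- (4) assemble
  have hR10 : (0 : ℝ) ≤ 1 + R₀ := by linarith
  have ha : Cu * (1 + R₀) * ρ ≤ |Cu| * (1 + R₀) * (1 + h) * ρ := by
    have h1 : Cu * (1 + R₀) * ρ ≤ |Cu| * (1 + R₀) * ρ :=
      mul_le_mul_of_nonneg_right (mul_le_mul_of_nonneg_right (le_abs_self _) hR10) hρ0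
    have h2 : 0 ≤ |Cu| * (1 + R₀) * h * ρ := by positivity
    linarith only [h1, h2]
  set S : ℝ := ∑ z ∈ X.filter (fun z => -R₀ - 2 ≤ z 2 ∧ z 2 ≤ h + R₀ + 2),
    ((12 : ℝ) - ((X.filter fun q => dist z q = 1).card : ℝ)) with hS
  have t1 : ((((P₁ ×ˢ (X \ P₁)).filter fun pq => dist pq.1 pq.2 = 1).card : ℕ) : ℝ) +
      ((((P₂ ×ˢ ((X \ P₁) \ P₂)).filter fun pq => dist pq.1 pq.2 = 1).card : ℕ) : ℝ) =
      contactDeficiency P₁ + contactDeficiency P₂ + contactDeficiency ((X \ P₁) \ P₂) -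
        contactDeficiency X := by linarith only [hs₁, hs₂]
  have t3 : 2 * φ₁ * Real.pi * ρ ^ 2 + 2 * φ₂ * Real.pi * ρ ^ 2 + S -
      (240 * Real.sqrt 2 * Real.pi + 5760 * (4 * R₀ + 2)) * (1 + h) * ρ ≤ 2 * contactDeficiency X := by
    convert hled using 7
  have t2 : c * Real.pi * ρ ^ 2 - C₀ * (1 + h) * ρ ≤ S := hpay
  have t4 : contactDeficiency P₁ ≤ 2 * φ₁ * Real.pi * ρ ^ 2 + Cu * (1 + R₀) * ρ := hD₁
  have t5 : contactDeficiency P₂ ≤ 2 * φ₂ * Real.pi * ρ ^ 2 + Cu * (1 + R₀) * ρ := hD₂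
  -- the numeral part of the old constant is dominated by `(120 √2 π + 11520) (1 + R₀)`
  have hnum : (240 * Real.sqrt 2 * Real.pi + 5760 * (4 * R₀ + 2)) / 2 * ((1 + h) * ρ) ≤
      (120 * Real.sqrt 2 * Real.pi + 11520) * (1 + R₀) * ((1 + h) * ρ) := by
    refine mul_le_mul_of_nonneg_right ?_ (by positivity)
    have hsp : 0 ≤ 120 * Real.sqrt 2 * Real.pi * R₀ := by
      have : (0 : ℝ) ≤ R₀ := by linarith
      positivity
    nlinarith only [hsp, hR₀]
  have e1 : (240 * Real.sqrt 2 * Real.pi + 5760 * (4 * R₀ + 2)) * (1 + h) * ρ =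
      2 * ((240 * Real.sqrt 2 * Real.pi + 5760 * (4 * R₀ + 2)) / 2 * ((1 + h) * ρ)) := by ring
  have e2 : ((2 * |Cu| + 120 * Real.sqrt 2 * Real.pi + 11520) * (1 + R₀) + C₀ / 2) * (1 + h) * ρ =
      2 * (|Cu| * (1 + R₀) * (1 + h) * ρ) + (120 * Real.sqrt 2 * Real.pi + 11520) * (1 + R₀) * ((1 + h) * ρ) +
        C₀ / 2 * (1 + h) * ρ := by ring
  rw [e2]
  rw [e1] at t3
  linarith only [t1, t2, t3, t4, t5, ha, hnum]

end Summit.Ventures.Crystal3D.Theorems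

end
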